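import Literature.NumberTheory.LFunctions.BurnolZetaSystems
import HarnessLib

/-!
# Zeros and evaluators for general Sonine functions (Burnol 2004, §7): `a₁(𝒵) = a₂(𝒵)`, the density
# `(T/2π) log T` of the zeros of a Sonine function, and `a(𝒵_g) = a(g)`

LINE 1 — LABEL: RH-FREE (theorems about an ARBITRARY multiset `𝒵 ⊂ ℂ` and about the zeros of an
arbitrary non-zero Sonine function; the Riemann zeta function does not occur). FRAMING (cell rh-crit,
D-0074): corpus theorems are RH-FREE literature; nothing here is worded as progress toward RH.
bears_on: B-C/B-P (LADDER-RH COLUMN 6, de Branges framework). WHAT THIS IS NOT: not a route, not a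
criterion; "The Riemann Hypothesis of course does not hold for all Sonine functions" (§8, TeX l.1915–1920).
Nothing here bears on the truth of RH.

Source: J.-F. Burnol, *Two complete and minimal systems associated with the zeros of the Riemann zeta
function*, J. Théor. Nombres Bordeaux 16 (2004) 65–94 = arXiv:math/0203120v7, §7 "Zeros and evaluators for
general Sonine functions" (bib key `Burnol2004b`; locators = arXiv v7 page + line of the cell's TeX of
record `dbl/src/Burnol2004JTNB_arXivmath0203120v7.tex`). Typed AS PRINTED as named facts over the objects of
`BurnolZetaSystems.lean` (`sonineK`, `rightMellin`, `IsCompleteSystemIn`, `IsMinimalSystem`): Thms. 7.1,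
7.2, 7.3, Lemmas 7.4, 7.5, 7.6, Thm. 7.7 (growth and zero density of the completed Mellin transform of a
Sonine function), Thm. 7.8, Props. 7.9, 7.10.

## Dictionary and design choices

* a multiset `𝒵` of complex numbers ("a countable collection of complex numbers, each assigned a finite
  multiplicity", TeX l.1382–1384) ↦ `Z : ℂ → ℕ` (multiplicity function; non-empty: `Z ≠ 0`; countable
  support); its index set `{(w,k) : k < Z w}` ↦ `MultisetIndex Z`.
* "the associated evaluators … in a Sonine space `K_a`" (TeX l.1384–1389) ↦ `sonineZ a w k`, the vector of
  `K_a` representing `f ↦ 𝒢_f^{(k)}(w)` for the bilinear form `∫₀^∞ f g`, where `𝒢_f` is the ENTIRE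
  completed Mellin transform of `f ∈ K_a` (Thm. 2.1) ↦ `completedMellinEntire f` (the entire function
  agreeing with `Γ_ℝ(s) f̂(s)` on the strip `1/2 < Re s < 1` when one exists; unique by the
  identity theorem, `HasCompletedMellinEntire.eq` of the sibling Proofs file; Hilbert-`ε` junk otherwise). This is needed because a general multiset
  (in particular `𝒵_g`, TeX l.1530–1536) may contain the poles `0, −2, −4, …` of `Γ_ℝ`, where the product
  `completedMellin` of `BurnolZetaSystems.lean` is not the printed `𝒢`; off those points `sonineZ` and
  `burnolZ` represent the same functional (given Thm. 2.1), see the docstring of `IsSonineZ`.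
* the indices `a₁(𝒵)`, `a₂(𝒵) ∈ [0,+∞]` (TeX l.1389–1398) ↦ `sonineMinimalIndex Z := sup {a : minimal in
  K_a}`, `sonineCompleteIndex Z := inf {a : complete in K_a}` in `ℝ≥0∞` (the printed thresholds; the
  monotonicity in `a` that makes them thresholds — "evaluators in `K_a` projecting orthogonally to the
  evaluators in `K_b` for `b ≥ a`" — is part of the printed discussion, not restated).
* "`g` is a Sonine function if it belongs to `⋃_{a>0} K_a`" (TeX l.1430–1433) ↦ `IsSonineFunction g`;
  `λ(g)`, `μ(g)` = the minimal points of the supports of `g` and `𝓕₊g`, `a(g) = √(λ(g)μ(g))`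
  (TeX l.1524–1528) ↦ `sonineLambda g`, `sonineLambda (𝓕 g)`, `sonineA g`.
* `𝒵_g` = the multiset of non-trivial zeros of `g`, i.e. of the zeros of the ENTIRE function `𝒢_g`
  ("so `0, −2, …` might be among them but they are counted with multiplicity one less than in `ĝ`",
  TeX l.1530–1536) ↦ `sonineZeros g w := analyticOrderAt 𝒢_g w`.
* Thm. 7.7's vocabulary from Levin's *Distribution of zeros of entire functions* (normal type for the
  refined order `r log r`, indicator function, rays of completely regular growth, TeX l.1582–1629) is
  typed by its concrete `limsup` / density / counting content, centred at `s = 1/2` as in the statement's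
  sectors `|arg(z − 1/2) ∓ π/2| < ε`; the zero counts "of modulus at most `T`" use `|ρ| ≤ T` as printed.

Deliberately NOT here: the background on Nevanlinna functions, mean type and Kreĭn's theorem
(TeX l.1538–1581) and the Remarks after Thm. 7.7 (Hadamard product, class A, the structure functions
`𝒜_a`, `ℬ_a` of [Burnol2002CRAS], TeX l.1714–1750). No statement of this module is proved here
(statements only; the uniqueness of `completedMellinEntire` is proved in `BurnolZetaSystemsProofs.lean`).
-/

noncomputable section

open MeasureTheory Complex Filter Set
open scoped ComplexConjugate FourierTransform Topology ENNReal

namespace Literature.NumberTheory.LFunctions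

/-! ## The entire completed Mellin transform `𝒢_f` of `f ∈ K_a` and the evaluators at every `w ∈ ℂ` -/

/-- RH-FREE (definition). `M` is an ENTIRE continuation of the completed right Mellin transform
`Γ_ℝ(s) f̂(s)` from the strip `1/2 < Re s < 1` (exists for `f ∈ K_a` by Thm. 2.1 = de Branges 1964;
unique by the identity theorem — `HasCompletedMellinEntire.eq` in `BurnolZetaSystemsProofs.lean`).
[cite: Burnol2004b, Thm. 2.1 (arXiv:math/0203120v7 p. 5, TeX l.437–443)] -/
def HasCompletedMellinEntire (f : ℝ → ℂ) (M : ℂ → ℂ) : Prop :=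
  Differentiable ℂ M ∧ ∀ s : ℂ, 1 / 2 < s.re → s.re < 1 → M s = Gammaℝ s * rightMellin f s

/-- RH-FREE object. `𝒢_f`: THE entire completed Mellin transform of `f` ("Gamma-completed Mellin transform
`𝒢(s)`", TeX l.1634–1636): the entire function agreeing with `π^{−s/2}Γ(s/2) f̂(s)` on `1/2 < Re s < 1`
when one exists (`f ∈ K_a`, Thm. 2.1), an unspecified function otherwise (Hilbert's `ε`, documented
junk). Off the poles `0, −2, −4, …` of `Γ_ℝ` it agrees with `completedMellin f` of
`BurnolZetaSystems.lean` (when both continuations exist).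
[cite: Burnol2004b, Thm. 2.1 and Thm. 7.7 (arXiv:math/0203120v7 pp. 5, 20; TeX l.437–443, 1633–1647)] -/
def completedMellinEntire (f : ℝ → ℂ) : ℂ → ℂ :=
  Classical.epsilon (fun M : ℂ → ℂ ↦ HasCompletedMellinEntire f M)

/-- RH-FREE (defining relation). `Z` IS the evaluator of `K_a` at `(w, k)` for an ARBITRARY `w ∈ ℂ`:
`Z ∈ K_a` and `∫₀^∞ f Z = 𝒢_f^{(k)}(w)` for all `f ∈ K_a` (Thm. 2.1: "The evaluations at complex numbers
`w ∈ ℂ` are continuous linear forms on `K_a`"; Riesz for the bilinear form). For `w ∉ {0, −2, −4, …}` this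
is the relation `IsBurnolZ a w k Z` of `BurnolZetaSystems.lean` (given Thm. 2.1, `𝒢_f = Γ_ℝ · G_f` near
such `w`). [cite: Burnol2004b, Thm. 2.1 and §7 (arXiv:math/0203120v7 pp. 5, 17; TeX l.437–443, 1382–1389)] -/
def IsSonineZ (a : ℝ) (w : ℂ) (k : ℕ) (Z : Lp ℂ 2 (volume : Measure ℝ)) : Prop :=
  Z ∈ sonineK a ∧ ∀ f ∈ sonineK a,
    ∫ t in Set.Ioi (0 : ℝ), f t * Z t = iteratedDeriv k (completedMellinEntire f) w

/-- RH-FREE object. The evaluator of `K_a` at `(w, k)`, any `w ∈ ℂ` (the vector satisfying `IsSonineZ`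
when it exists — Thm. 2.1 + Riesz —, Hilbert-`ε` junk otherwise).
[cite: Burnol2004b, §7 (arXiv:math/0203120v7 p. 17, TeX l.1382–1389)] -/
def sonineZ (a : ℝ) (w : ℂ) (k : ℕ) : Lp ℂ 2 (volume : Measure ℝ) :=
  Classical.epsilon (fun Z : Lp ℂ 2 (volume : Measure ℝ) ↦ IsSonineZ a w k Z)

/-! ## Multisets and their evaluators; the indices `a₁(𝒵)`, `a₂(𝒵)` -/

/-- RH-FREE object. The index set `{(w, k) : 0 ≤ k < 𝒵(w)}` of the evaluators associated with a multiset
`𝒵` (multiplicity function `Z : ℂ → ℕ`). [cite: Burnol2004b, §7 (arXiv:math/0203120v7 p. 17, TeX l.1382–1389)] -/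
def MultisetIndex (Z : ℂ → ℕ) : Type :=
  {p : ℂ × ℕ // p.2 < Z p.1}

/-- RH-FREE object. The system of evaluators of `K_a` associated with the multiset `𝒵`.
[cite: Burnol2004b, §7 (arXiv:math/0203120v7 p. 17, TeX l.1382–1389)] -/
def sonineZSystem (a : ℝ) (Z : ℂ → ℕ) : MultisetIndex Z → Lp ℂ 2 (volume : Measure ℝ) :=
  fun p ↦ sonineZ a p.1.1 p.1.2

/-- RH-FREE object. `a₁(𝒵) ∈ [0, +∞]`: "the evaluators are a minimal system for `a < a₁(𝒵)` and not a
minimal system for `a > a₁(𝒵)`", typed as the supremum of the `a > 0` for which the system is minimal in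
`K_a` (`0` if never, `+∞` if always). [cite: Burnol2004b, §7 (arXiv:math/0203120v7 p. 17, TeX l.1389–1398)] -/
def sonineMinimalIndex (Z : ℂ → ℕ) : ℝ≥0∞ :=
  sSup {x : ℝ≥0∞ | ∃ a : ℝ, 0 < a ∧ x = ENNReal.ofReal a ∧ IsMinimalSystem (sonineZSystem a Z)}

/-- RH-FREE object. `a₂(𝒵) ∈ [0, +∞]`: "the evaluators are complete for `a > a₂(𝒵)` but not complete for
`a < a₂(𝒵)`", typed as the infimum of the `a > 0` for which the system is complete in `K_a` (`+∞` if never,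
`0` if always). [cite: Burnol2004b, §7 (arXiv:math/0203120v7 p. 17, TeX l.1389–1398)] -/
def sonineCompleteIndex (Z : ℂ → ℕ) : ℝ≥0∞ :=
  sInf {x : ℝ≥0∞ | ∃ a : ℝ, 0 < a ∧ x = ENNReal.ofReal a ∧
    IsCompleteSystemIn (sonineK a) (sonineZSystem a Z)}

/-- RH-FREE (named fact, Thm. 7.1). "The equality `a₁(𝒵) = a₂(𝒵)` always holds" (for a non-empty
multiset `𝒵`; e.g. `a₁ = a₂ = 0` if `𝒵` has an accumulation point, `= +∞` if `𝒵` is finite, `= 1` for the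
zeros of `ζ`, TeX l.1398–1407). [cite: Burnol2004b, Thm. 7.1 (arXiv:math/0203120v7 p. 17, TeX l.1409–1411)] -/
def Burnol2004b_thm7_1 : Prop :=
  ∀ Z : ℂ → ℕ, Z ≠ 0 → (Function.support Z).Countable → sonineMinimalIndex Z = sonineCompleteIndex Z

/-- RH-FREE (named fact, Thm. 7.2, with `a(𝒵) := a₁(𝒵) = a₂(𝒵)`). "If `0 < a < a(𝒵)` then the evaluators
associated to `𝒵` remain not complete, and minimal, in `K_a`, after including arbitrarily finitely many
other evaluators." (Other evaluators: those of a finite multiset `F`, the system of `𝒵 + F`.)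
[cite: Burnol2004b, Thm. 7.2 (arXiv:math/0203120v7 p. 18, TeX l.1418–1422)] -/
def Burnol2004b_thm7_2 : Prop :=
  ∀ Z : ℂ → ℕ, Z ≠ 0 → (Function.support Z).Countable → ∀ a : ℝ, 0 < a →
    ENNReal.ofReal a < sonineMinimalIndex Z → ∀ F : ℂ → ℕ, (Function.support F).Finite →
      IsMinimalSystem (sonineZSystem a (Z + F)) ∧
        ¬ IsCompleteSystemIn (sonineK a) (sonineZSystem a (Z + F))

/-- RH-FREE (named fact, Thm. 7.3). "If `a(𝒵) < a < ∞` then the evaluators associated to `𝒵` remain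
complete, and not minimal, in `K_a` after omitting arbitrarily finitely many among them."
[cite: Burnol2004b, Thm. 7.3 (arXiv:math/0203120v7 p. 18, TeX l.1424–1428)] -/
def Burnol2004b_thm7_3 : Prop :=
  ∀ Z : ℂ → ℕ, Z ≠ 0 → (Function.support Z).Countable → ∀ a : ℝ, 0 < a →
    sonineCompleteIndex Z < ENNReal.ofReal a → ∀ S : Finset (MultisetIndex Z),
      IsCompleteSystemIn (sonineK a) (fun p : {p : MultisetIndex Z // p ∉ S} ↦ sonineZSystem a Z p.1) ∧
        ¬ IsMinimalSystem (fun p : {p : MultisetIndex Z // p ∉ S} ↦ sonineZSystem a Z p.1)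

/-- RH-FREE (named fact, Lemma 7.4). "If the system of evaluators associated in a given `K_a` to a
(non-empty) multiset `𝒵` is not complete, then it is minimal. Alternatively, if it is not minimal, it has
to be complete." (Printed proof: divide a non-zero Sonine function vanishing on `𝒵` by powers of `s − ρ`,
Prop. 4.3.) [cite: Burnol2004b, Lemma 7.4 (arXiv:math/0203120v7 p. 18, TeX l.1435–1459)] -/
def Burnol2004b_lemma7_4 : Prop :=
  ∀ Z : ℂ → ℕ, Z ≠ 0 → (Function.support Z).Countable → ∀ a : ℝ, 0 < a →
    ¬ IsCompleteSystemIn (sonineK a) (sonineZSystem a Z) → IsMinimalSystem (sonineZSystem a Z)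

/-- RH-FREE (named fact, Lemma 7.5). "If the system of evaluators associated in a given `K_a` to a
(non-empty) multiset `𝒵` is minimal, then it is not complete in any `K_b` with `b < a`." (Printed proof:
smoothing `θ(s)G(s)` with `θ` the Mellin transform of a smooth function supported in `[e^{−ε}, e^{ε}]`,
Thms. 4.8–4.9.) [cite: Burnol2004b, Lemma 7.5 (arXiv:math/0203120v7 p. 18, TeX l.1467–1491)] -/
def Burnol2004b_lemma7_5 : Prop :=
  ∀ Z : ℂ → ℕ, Z ≠ 0 → (Function.support Z).Countable → ∀ a : ℝ, 0 < a →
    IsMinimalSystem (sonineZSystem a Z) → ∀ b : ℝ, 0 < b → b < a →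
      ¬ IsCompleteSystemIn (sonineK b) (sonineZSystem b Z)

/-- RH-FREE (named fact, Lemma 7.6). "If the system of evaluators associated in a given `K_a` to a
(non-empty) multiset `𝒵` is minimal, then it is not complete in any `K_b` with `b < a`, even after adding
to the system of evaluators associated with `𝒵` arbitrarily finitely many other evaluators."
[cite: Burnol2004b, Lemma 7.6 (arXiv:math/0203120v7 p. 19, TeX l.1498–1510)] -/
def Burnol2004b_lemma7_6 : Prop :=
  ∀ Z : ℂ → ℕ, Z ≠ 0 → (Function.support Z).Countable → ∀ a : ℝ, 0 < a →
    IsMinimalSystem (sonineZSystem a Z) → ∀ b : ℝ, 0 < b → b < a →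
      ∀ F : ℂ → ℕ, (Function.support F).Finite →
        ¬ IsCompleteSystemIn (sonineK b) (sonineZSystem b (Z + F))

/-! ## Sonine functions, `λ(g)`, `μ(g)`, `a(g)`, and the multiset `𝒵_g` of non-trivial zeros -/

/-- RH-FREE (definition). "We will say that `g(t)` is a Sonine function if it belongs to
`⋃_{a>0} K_a ⊂ L²(0,∞; dt)`." [cite: Burnol2004b, §7 (arXiv:math/0203120v7 p. 18, TeX l.1430–1433)] -/
def IsSonineFunction (g : Lp ℂ 2 (volume : Measure ℝ)) : Prop :=
  ∃ a : ℝ, 0 < a ∧ g ∈ sonineK a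

/-- RH-FREE object. `λ(g) > 0`, "the minimal point of the support of `g`": the supremum of the `a` with
`g = 0` a.e. on `(0, a)` (for a non-zero Sonine function a positive real; junk for `g = 0`). `μ(g)` is
`λ(𝓕₊ g)`. [cite: Burnol2004b, §7 (arXiv:math/0203120v7 p. 19, TeX l.1524–1528)] -/
def sonineLambda (g : Lp ℂ 2 (volume : Measure ℝ)) : ℝ :=
  sSup {a : ℝ | ∀ᵐ x : ℝ, x ∈ Set.Ioo 0 a → g x = 0}

/-- RH-FREE object. `a(g) := √(λ(g) μ(g))` with `μ(g) = λ(𝓕₊ g)` the minimal point of the support of the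
cosine transform. [cite: Burnol2004b, §7 (arXiv:math/0203120v7 p. 19, TeX l.1524–1528)] -/
def sonineA (g : Lp ℂ 2 (volume : Measure ℝ)) : ℝ :=
  Real.sqrt (sonineLambda g * sonineLambda (𝓕 g : Lp ℂ 2 (volume : Measure ℝ)))

/-- RH-FREE object. The multiset `𝒵_g` of non-trivial zeros of a Sonine function `g`: "the zeros of the
completed Mellin transform `π^{−s/2}Γ(s/2)ĝ(s)`, so `0, −2, …, might be among them but they are counted
with multiplicity one less than in `ĝ(s)`" — i.e. the multiplicity of `w` as a zero of the entire function
`𝒢_g` (Mathlib's `analyticOrderAt`, as a natural number; `0` off the zeros).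
[cite: Burnol2004b, §7 (arXiv:math/0203120v7 p. 19, TeX l.1530–1536)] -/
def sonineZeros (g : Lp ℂ 2 (volume : Measure ℝ)) (w : ℂ) : ℕ :=
  (analyticOrderAt (completedMellinEntire g) w).toNat

/-- RH-FREE object. Zero counting for Thm. 7.7: the number of zeros `ρ` of `𝒢_g` (with multiplicity) of
modulus `|ρ| ≤ T` satisfying the (sector) condition `P`. A `finsum` (finite for a non-zero Sonine
function, junk `0` otherwise). [cite: Burnol2004b, Thm. 7.7 (arXiv:math/0203120v7 p. 20, TeX l.1633–1647)] -/
def sonineZeroCount (g : Lp ℂ 2 (volume : Measure ℝ)) (P : ℂ → Prop) (T : ℝ) : ℝ :=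
  ∑ᶠ ρ ∈ {ρ : ℂ | ‖ρ‖ ≤ T ∧ P ρ}, (sonineZeros g ρ : ℝ)

/-! ## Thm. 7.7: growth and distribution of the zeros of `𝒢_g` -/

/-- RH-FREE (named fact, Thm. 7.7). "Let `g(t)` be a non-zero Sonine function, with Mellin transform
`G(s)`, and Gamma-completed Mellin transform `𝒢(s)`. The entire function `𝒢(s)` is of normal type for the
Lindelöf refined order `r log(r)`. Its indicator function is `½|cos(θ)|`. The entire function `𝒢(s)` is a
function of completely regular growth. The number of its zeros of modulus at most `T` in the angular
sector `|arg(z − 1/2) − π/2| < ε < π` is asymptotically equivalent to `(T/2π) log(T)`, and similarly for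
the angular sectors containing the lower-half of the critical line. The number of zeros of `𝒢(s)` with
modulus at most `T` in `|arg(±z)| < π/2 − ε` is `o(T)`." Typed concretely (rays and circles centred at
`1/2`; Levin's definitions, TeX l.1582–1629): (i) normal type: `0 < limsup_r log max_{|s−1/2|=r}|𝒢| /
(r log r) < ∞`; (ii) indicator: `limsup_r log|𝒢(1/2 + re^{iθ})|/(r log r) = ½|cos θ|` for every `θ`;
(iii) completely regular growth: on every ray the `limsup` is a limit outside a set `E_θ ⊂ (0,∞)` of zero
upper relative linear density; (iv)–(vi) the three zero counts.
[cite: Burnol2004b, Thm. 7.7 (arXiv:math/0203120v7 p. 20, TeX l.1633–1712)] -/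
def Burnol2004b_thm7_7 : Prop :=
  ∀ g : Lp ℂ 2 (volume : Measure ℝ), IsSonineFunction g → g ≠ 0 →
    (IsBoundedUnder (· ≤ ·) atTop (fun r : ℝ ↦
        Real.log (sSup ((fun s : ℂ ↦ ‖completedMellinEntire g s‖) '' Metric.sphere (1 / 2 : ℂ) r)) /
          (r * Real.log r)) ∧
      0 < limsup (fun r : ℝ ↦
        Real.log (sSup ((fun s : ℂ ↦ ‖completedMellinEntire g s‖) '' Metric.sphere (1 / 2 : ℂ) r)) /
          (r * Real.log r)) atTop) ∧
    (∀ θ : ℝ,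
      IsBoundedUnder (· ≤ ·) atTop (fun r : ℝ ↦
        Real.log ‖completedMellinEntire g (1 / 2 + r * cexp (θ * I))‖ / (r * Real.log r)) ∧
      limsup (fun r : ℝ ↦
        Real.log ‖completedMellinEntire g (1 / 2 + r * cexp (θ * I))‖ / (r * Real.log r)) atTop
          = |Real.cos θ| / 2) ∧
    (∀ θ : ℝ, ∃ E : Set ℝ, MeasurableSet E ∧
      Tendsto (fun r : ℝ ↦ (volume (E ∩ Set.Ioo 0 r)).toReal / r) atTop (𝓝 0) ∧
      Tendsto (fun r : ℝ ↦
        Real.log ‖completedMellinEntire g (1 / 2 + r * cexp (θ * I))‖ / (r * Real.log r))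
        (atTop ⊓ 𝓟 Eᶜ) (𝓝 (|Real.cos θ| / 2))) ∧
    (∀ ε : ℝ, 0 < ε → ε < Real.pi →
      Tendsto (fun T : ℝ ↦ sonineZeroCount g
          (fun ρ ↦ |Complex.arg (ρ - 1 / 2) - Real.pi / 2| < ε) T / (T / (2 * Real.pi) * Real.log T))
        atTop (𝓝 1) ∧
      Tendsto (fun T : ℝ ↦ sonineZeroCount g
          (fun ρ ↦ |Complex.arg (ρ - 1 / 2) + Real.pi / 2| < ε) T / (T / (2 * Real.pi) * Real.log T))
        atTop (𝓝 1)) ∧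
    (∀ ε : ℝ, 0 < ε → ε < Real.pi / 2 →
      Tendsto (fun T : ℝ ↦ sonineZeroCount g
          (fun ρ ↦ |Complex.arg ρ| < Real.pi / 2 - ε ∨ |Complex.arg (-ρ)| < Real.pi / 2 - ε) T / T)
        atTop (𝓝 0))

/-! ## Thm. 7.8 and Props. 7.9, 7.10 -/

/-- RH-FREE (named fact, Thm. 7.8). "For each non-zero Sonine function there holds: `a(𝒵_g) = a(g)`. This
means in particular that `g` has infinitely many (non-trivial) zeros, that the evaluators associated to
`𝒵_g` are minimal but not complete in `K_a` if `a ≤ a(g)` and that they are complete, even after omitting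
arbitrarily finitely many among them, in `K_a` if `a > a(g)`." (`a(𝒵)` = `a₁(𝒵)` = `a₂(𝒵)`, Thm. 7.1;
both typed.) [cite: Burnol2004b, Thm. 7.8 (arXiv:math/0203120v7 p. 22, TeX l.1756–1799)] -/
def Burnol2004b_thm7_8 : Prop :=
  ∀ g : Lp ℂ 2 (volume : Measure ℝ), IsSonineFunction g → g ≠ 0 →
    sonineMinimalIndex (sonineZeros g) = ENNReal.ofReal (sonineA g) ∧
    sonineCompleteIndex (sonineZeros g) = ENNReal.ofReal (sonineA g) ∧
    (Function.support (sonineZeros g)).Infinite ∧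
    (∀ a : ℝ, 0 < a → a ≤ sonineA g →
      IsMinimalSystem (sonineZSystem a (sonineZeros g)) ∧
        ¬ IsCompleteSystemIn (sonineK a) (sonineZSystem a (sonineZeros g))) ∧
    (∀ a : ℝ, sonineA g < a → ∀ S : Finset (MultisetIndex (sonineZeros g)),
      IsCompleteSystemIn (sonineK a)
        (fun p : {p : MultisetIndex (sonineZeros g) // p ∉ S} ↦ sonineZSystem a (sonineZeros g) p.1))

/-- RH-FREE (named fact, Prop. 7.9). "If `f` and `g` are two non-zero Sonine functions such that
`𝒵_g ⊂ 𝒵_f` then the entire function `F(s)/G(s)` has finite exponential type and `a(f) ≤ a(g)`."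
(Multiset inclusion = pointwise `≤` of multiplicities; `F/G = 𝒢_f/𝒢_g`, typed as the entire `θ` with
`𝒢_f = θ 𝒢_g`.) [cite: Burnol2004b, Prop. 7.9 (arXiv:math/0203120v7 p. 22, TeX l.1803–1819)] -/
def Burnol2004b_prop7_9 : Prop :=
  ∀ f g : Lp ℂ 2 (volume : Measure ℝ), IsSonineFunction f → f ≠ 0 → IsSonineFunction g → g ≠ 0 →
    (∀ w : ℂ, sonineZeros g w ≤ sonineZeros f w) →
      (∃ θ : ℂ → ℂ, Differentiable ℂ θ ∧
        (∀ s : ℂ, completedMellinEntire f s = θ s * completedMellinEntire g s) ∧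
        ∃ C τ : ℝ, ∀ s : ℂ, ‖θ s‖ ≤ C * Real.exp (τ * ‖s‖)) ∧
      sonineA f ≤ sonineA g

/-- RH-FREE (named fact, Prop. 7.10). "If `f` and `g` are two non-zero Sonine functions such that
`𝒵_f = 𝒵_g` then `f` and `g` are multiplicative translates of one another, up to multiplication by a
non-zero complex number." (Printed proof: Hadamard product gives `f̂ = e^{λ+μs} ĝ`; Wiener's theorem on the
gain of a causal filter forces `μ ∈ ℝ`.) [cite: Burnol2004b, Prop. 7.10 (arXiv:math/0203120v7 p. 23, TeX l.1823–1839)] -/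
def Burnol2004b_prop7_10 : Prop :=
  ∀ f g : Lp ℂ 2 (volume : Measure ℝ), IsSonineFunction f → f ≠ 0 → IsSonineFunction g → g ≠ 0 →
    sonineZeros f = sonineZeros g →
      ∃ c : ℂ, c ≠ 0 ∧ ∃ l : ℝ, 0 < l ∧ ∀ᵐ t : ℝ, f t = c * g (l * t)

end Literature.NumberTheory.LFunctions
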